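import Literature.AnabelianGeometry.EtaleTheta.Discharge.Sec1Thm110ModelChiDeck
import Literature.AnabelianGeometry.EtaleTheta.SettingModelChiKummerDataNondeg
import Literature.AnabelianGeometry.EtaleTheta.SettingModelTateThetaOddShear
import Literature.AnabelianGeometry.EtaleTheta.Discharge.Sec1AnchoredDeckPoint
import HarnessLib

/-!
# [EtTh] Def. 1.9 at the χ-twisted model: the DECK ELEMENT IS THE `μ₂`-DECK TRANSFORMATION — it sends the
# coordinate class `log(Ü)` to `log(Ü) + log(−1)`, i.e. `Ü ↦ −Ü` («the 4-torsion point `τ⁻¹` determined by `−√−1`»)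

S. Mochizuki, *The étale theta function and its Frobenioid-theoretic manifestations*, Publ. RIMS **45** (2009) [EtTh],
§1: Prop. 1.5 p. 23 ("`log(Ü)`", the Kummer class of the coordinate of `Ÿ`), Def. 1.9 p. 29 (PRIMS p. 255: "`√−1`
determines a 4-torsion point `τ` … the 4-torsion point `τ⁻¹` determined by `−√−1` admits a similar description";
`Ÿ → Y` is the double covering with `Ü² = U`, deck transformation `Ü ↦ −Ü`) [cite: MochizukiEtTh2009, Def 1.9 p.29].
Layer L2 of the abc-iut cell, seat abc-iut-w5-d140 (gen 4; K2 holder lineage), sequel of this lineage's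
`Discharge/Sec1Thm110ModelChiDeck` (p442729: a deck element `ε = b^t` of degree `0` with `D_{τ⁻¹} = ε⁻¹·D_τ·ε` EXISTS at
`modelχ`) — PROOF-ONLY over abc-iut-w5-d171's `yCoordχ` / `logUddχ` / `yCoordχ_inl_bPowGfp` /
`conjNormal_toTheta_eq_self` (`SettingModelChiKummerData(Nondeg)`), abc-iut-L2-t6's `kappaUnitχ` / `kummerDataχSec`
(`SettingModelChiAnchoredPoints` / `…SectionPoints`), abc-iut-L2-t5's `kummerZH` calculus and `levelChar_two_eq_one`
(`SettingModelTateThetaOddShear`), abc-iut-L2-d1's `exists_anchoredPoint_translates_of_prop15ii` via this lineage's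
`exists_anchoredStandardData_of_deck` (p431196), abc-iut-L6-d5's `prop15ii_kummerDataχSec` — all BY NAME.

THE POINT. p442729 found the deck element from the DECOMPOSITION GROUPS alone (`D_{τ⁻¹} = ε⁻¹ D_τ ε`). Print's deck
transformation of `Ÿ → Y` moreover NEGATES THE COORDINATE: `Ü ↦ −Ü`, i.e. on Kummer classes
`ε · log(Ü) = log(Ü) + log(−1)` — the hypothesis `hε` of this lineage's `exists_anchoredStandardData_of_deck`. THIS FILE
proves that the deck element satisfies it:
* `inflTheta_kumYdd_toKddHat_kummerDataχSec` — the inflated Kummer class of a constant `u` of the section datum IS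
  the class of `g ↦ c^{κ_u(aug g)}` (definitionally);
* `conj_inl_bPowGfp_inflTheta_logUddχ` — **conjugating `log(Ü) = c^{ŷ/2}` by `b^t` multiplies it by the class of
  `g ↦ c^{(χ(aug g)−1)·t/2}`** (`ŷ(b^{−t} g b^{t}) = ŷ(g)·χ(aug g)(t)·t⁻¹`; `(χ−1)t ∈ 2Ẑ` since `χ ≡ 1 (mod 2)`);
* `exists_odd_deck_exponent` — the deck exponent `t := c₁·c₀⁻²` of p442729 can be taken ODD (`level 2 t ≠ 1`): `c₁`
  is the discrete logarithm of a compatible system of roots of unity whose level-`2` member is `((√−1)⁻¹)² = −1 ≠ 1`;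
* `cocycle_half_chi_sub_one_eq_kappa_negOne_of_odd` — for ODD `t`, `g ↦ c^{(χ−1)t/2}` and the Kummer cocycle
  `g ↦ c^{κ_{−1}(aug g)}` of `−1` differ by a COBOUNDARY (`2κ_{−1} = (χ−1)·c'` with `c'` odd, and `Ẑ` is `2`-torsion-free);
* **`conj_deck_inflTheta_logUddχ`** / **`exists_deck_negates_coord_modelχ`**: there is `ε = b^t ∈ Π^tp_X` of degree `0`
  with BOTH `D_{τ⁻¹} = D_τ.comap (conj ε)` (τ^{±1} = `anchoredPointχ (√−1)^{±1}`) AND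
  `ε · infl log(Ü) = infl log(Ü) · infl κ̈(−1)` — the deck element IS print's `μ₂`-deck transformation `Ü ↦ −Ü`;
* `exists_anchoredStandardData_of_deck_modelχ` — consequently this lineage's p431196 FIRES at the model with every
  hypothesis discharged (anchored `τ` with `Ü(τ) = √−1`, `Prop15ii`, `hε`).

HONEST FRAMING: SEMI-SYNTHETIC model (the χ-twisted root; not the tempered `π₁` of a curve) — consistency / non-vacuity
evidence for the typed interface ONLY; nothing of [EtTh] is asserted; typed ≠ proved; no side is taken on [IUTchIII]
Cor. 3.12. PROOF-ONLY: no definition, no instance, no `Prop` fact.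
-/

noncomputable section

namespace Literature.AnabelianGeometry.EtaleTheta.SettingModel

open Literature.AnabelianGeometry.SemiGraphs Literature.AnabelianGeometry.AbsoluteAnabelian
open _root_.Topology _root_.Function

variable (p : ℕ) [Fact p.Prime]

/-! ### §1. The Kummer cocycle of a constant of the section datum -/

/-- `g ↦ c^{κ_u(aug g)}` is a continuous cocycle on `Π^tp_Ÿ` (the `χ`-cocycle law of `κ_u` and the `χ`-equivariance of
`c^{·}`). [cite: MochizukiEtTh2009, Prop 1.5 p.23] -/
theorem kappaUnitχ_aug_mem_contCocycles (u : (↥(ThetaSetting.modelχ p).Kdd)ˣ) :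
    (fun g : ↥(ThetaSetting.modelχ p).GtpYdd => deltaThetaCoordχ p (kappaUnitχ p u (g : PiTpχ p).right)) ∈
      contCocycles (ThetaSetting.modelχ p).toTheta (ThetaSetting.modelχ p).DeltaTheta (ThetaSetting.modelχ p).GtpYdd := by
  refine ⟨(continuous_deltaThetaCoordχ p).comp ((continuous_kappaUnitχ p u).comp
    ((Semidirect.continuous_right (isInducing_leftRightχ p)).comp continuous_subtype_val)), fun g h => ?_⟩
  change deltaThetaCoordχ p (kappaUnitχ p u ((g : PiTpχ p) * (h : PiTpχ p)).right) =
    deltaThetaCoordχ p (kappaUnitχ p u (g : PiTpχ p).right) *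
      MulAut.conjNormal ((ThetaSetting.modelχ p).toTheta (g : PiTpχ p)) (deltaThetaCoordχ p (kappaUnitχ p u (h : PiTpχ p).right))
  rw [SemidirectProduct.mul_right, kappaUnitχ_mul, map_mul, ← deltaThetaCoordχ_chi]
  rfl

/-- **The inflated Kummer class of a constant `u ∈ K̈^×` of the section datum `kummerDataχSec` IS the class of
`g ↦ c^{κ_u(aug g)}`** (the core's Kummer cocycle factors through `augTheta ∘ toTheta = aug`; definitional unfolding).
[cite: MochizukiEtTh2009, Prop 1.5 p.23] -/
theorem inflTheta_kumYdd_toKddHat_kummerDataχSec (u : (↥(ThetaSetting.modelχ p).Kdd)ˣ) :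
    (ThetaSetting.modelχ p).inflTheta (ThetaSetting.modelχ p).GtpYdd
        ((kummerDataχSec p).kumYdd ((kummerDataχSec p).toKddHat u)) =
      ContH1.mk (fun g : ↥(ThetaSetting.modelχ p).GtpYdd => deltaThetaCoordχ p (kappaUnitχ p u (g : PiTpχ p).right))
        (kappaUnitχ_aug_mem_contCocycles p u) := by
  change ContH1.mk _ _ = ContH1.mk _ _
  exact ContH1.mk_congr _ (funext fun g => rfl) _ _

/-! ### §2. Parity-aware coboundaries -/

/-- A product of two `G_{ℚ_p}`-fixed units is fixed. [folklore] -/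
private theorem mul_mem_fixedPoints_top' {a b : (PadicAlgCl p)ˣ}
    (ha : a ∈ MulAction.fixedPoints (⊤ : Subgroup (GQp p)) (PadicAlgCl p)ˣ)
    (hb : b ∈ MulAction.fixedPoints (⊤ : Subgroup (GQp p)) (PadicAlgCl p)ˣ) :
    a * b ∈ MulAction.fixedPoints (⊤ : Subgroup (GQp p)) (PadicAlgCl p)ˣ :=
  mem_fixedPoints_top_of_forall fun σ => by
    have h1 : σ • a = a := ha ⟨σ, Subgroup.mem_top σ⟩
    have h2 : σ • b = b := hb ⟨σ, Subgroup.mem_top σ⟩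
    rw [smul_mul', h1, h2]

/-- `1 ∈ ℚ̄_p^×` is fixed. [folklore] -/
private theorem one_mem_fixedPoints_top' :
    (1 : (PadicAlgCl p)ˣ) ∈ MulAction.fixedPoints (⊤ : Subgroup (GQp p)) (PadicAlgCl p)ˣ :=
  mem_fixedPoints_top_of_forall fun σ => smul_one σ

/-- **Parity-aware coboundary**: for a root system `x` of a unit `u = 1` WHOSE LEVEL-`2` ROOT IS `−1` (i.e. NOT `1`), the
discrete logarithm `c` of the comparison cyclotome (`κ_x = χ(·)c/c`) is ODD: `level 2 c ≠ 1`.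
[cite: NeukirchANT1999, Ch. IV §3] -/
theorem exists_odd_coboundary_of_eq_one {u : (PadicAlgCl p)ˣ} (x : RootSystem u)
    (hu : u ∈ MulAction.fixedPoints (⊤ : Subgroup (GQp p)) (PadicAlgCl p)ˣ) (h1 : u = 1) (h2 : x.root 2 ≠ 1) :
    ∃ c : ZH, (∀ σ : GQp p, kummerZH x hu σ = chi p σ c * c⁻¹) ∧ ZHatLevel.level 2 c ≠ 1 := by
  refine ⟨cycEquiv p (RootSystem.divCyclotome RootSystem.one (x.cast h1)), fun σ => ?_, fun h => h2 ?_⟩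
  · rw [← kummerZH_cast x hu h1 (one_mem_fixedPoints_top' p) σ,
      kummerZH_eq_mul_coboundary RootSystem.one (one_mem_fixedPoints_top' p) (x.cast h1) σ,
      kummerZH_rootSystemOne, one_mul, div_eq_mul_inv]
  · rw [level_cycEquiv_eq_one_iff, RootSystem.divCyclotome_apply, RootSystem.cast_root] at h
    simpa [RootSystem.one] using h

/-- The abelian bookkeeping of p442729's `deck_algebra` (restated privately: that lemma is file-private). [folklore] -/
private theorem deck_algebra' {G : Type*} [CommGroup G] (χ : G →* G) {k k' c₀ c₁ : G}
    (hA : k * k' = χ c₀ * c₀⁻¹) (hB : k' * k' * (k' * k') = χ c₁ * c₁⁻¹) :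
    c₁ * c₀⁻¹ * c₀⁻¹ * (k' * k') * (χ (c₁ * c₀⁻¹ * c₀⁻¹))⁻¹ = k * k := by
  have hk : k = χ c₀ * c₀⁻¹ * k'⁻¹ := eq_mul_inv_of_mul_eq hA
  have hc : χ c₁ = k' * k' * (k' * k') * c₁ := by rw [hB, inv_mul_cancel_right]
  simp only [map_mul, map_inv]
  rw [hk, hc]
  apply Additive.ofMul.injective
  simp only [ofMul_mul, ofMul_inv]
  abel

/-- **The deck exponent can be taken ODD**: `∃ t`, `t · κ_{(√−1)⁻¹}(σ)² · (χ(σ)t)⁻¹ = κ_{√−1}(σ)²` for all `σ`, and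
`level 2 t ≠ 1` — because `t = c₁·c₀⁻²` with `c₁` the logarithm of the root-of-unity system `((√−1)^{−1/N})⁴`, whose
level-`2` member is `((√−1)⁻¹)² = −1`. [cite: MochizukiEtTh2009, Def 1.9 p.29] -/
theorem exists_odd_deck_exponent (hp : p % 4 = 1) :
    ∃ t : ZH, (∀ σ : GQp p,
      t * (kappaUnitχ p (sqrtNegOneInvUnitχ p hp) σ * kappaUnitχ p (sqrtNegOneInvUnitχ p hp) σ) * (chi p σ t)⁻¹ =
        kappaUnitχ p (sqrtNegOneUnitχ p hp) σ * kappaUnitχ p (sqrtNegOneUnitχ p hp) σ) ∧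
      ZHatLevel.level 2 t ≠ 1 := by
  obtain ⟨c₀, hc₀⟩ := exists_coboundary_kappa_mul_kappaInv p hp
  -- (B) with parity: the root system `x'⁴` of `((√−1)⁻¹)⁴ = 1` has level-2 root `(x'.root 2)⁴ = ((√−1)⁻¹)² = −1`
  set x' := RootSystem.ofRootableBy (unitχ p (sqrtNegOneInvUnitχ p hp)) with hx'
  have hf := unitχ_mem_fixedPoints p (sqrtNegOneInvUnitχ p hp)
  have hf2 := mul_mem_fixedPoints_top' p hf hf
  have hroot : ((x'.mul x').mul (x'.mul x')).root 2 ≠ 1 := by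
    intro h
    rw [RootSystem.mul_root, RootSystem.mul_root] at h
    have hsq : x'.root 2 * x'.root 2 = unitχ p (sqrtNegOneInvUnitχ p hp) := by
      rw [← pow_two]; exact x'.pow_self 2
    rw [hsq] at h
    have hval := congrArg (fun w : (PadicAlgCl p)ˣ => (w : PadicAlgCl p)) h
    simp only [Units.val_mul, Units.val_one] at hval
    change (sqrtNegOneχ p hp)⁻¹ * (sqrtNegOneχ p hp)⁻¹ = 1 at hval
    rw [← pow_two, sqrtNegOneχ_inv_sq] at hval
    norm_num at hval
  obtain ⟨c₁, hc₁, hodd⟩ := exists_odd_coboundary_of_eq_one p ((x'.mul x').mul (x'.mul x'))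
    (mul_mem_fixedPoints_top' p hf2 hf2) (unitχ_sqrtNegOneInv_pow_four p hp) hroot
  have hB : ∀ σ : GQp p,
      kappaUnitχ p (sqrtNegOneInvUnitχ p hp) σ * kappaUnitχ p (sqrtNegOneInvUnitχ p hp) σ *
        (kappaUnitχ p (sqrtNegOneInvUnitχ p hp) σ * kappaUnitχ p (sqrtNegOneInvUnitχ p hp) σ) =
      chi p σ c₁ * c₁⁻¹ := fun σ => by
    rw [← hc₁ σ, kummerZH_mulRoots _ _ hf2 hf2, kummerZH_mulRoots _ _ hf hf, kappaUnitχ_def]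
  refine ⟨c₁ * c₀⁻¹ * c₀⁻¹, fun σ => ?_, ?_⟩
  · letI : CommGroup ZH := { (inferInstance : Group ZH) with mul_comm := ZHatCompletion.mul_comm }
    exact deck_algebra' (chi p σ).toMonoidHom (hc₀ σ) (hB σ)
  · -- `level 2 (c₁ c₀⁻²) = level 2 c₁` (squares die mod 2)
    intro h
    apply hodd
    have hsq : ∀ z : Multiplicative (ZMod ((2 : ℕ+) : ℕ)), z⁻¹ * z⁻¹ = 1 := by decide
    rw [map_mul, map_mul, map_inv, mul_assoc, hsq, mul_one] at h
    exact h


/-! ### §3. The Kummer cocycle of `−1` with parity, and the squares bookkeeping -/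

/-- `χ(φ)(t) · t⁻¹ ∈ 2Ẑ` for every `φ ∈ Aut(Ẑ)` and `t ∈ Ẑ` (`χ ≡ 1 (mod 2)`). [cite: RibesZalesskii2010, Thm 2.7.1] -/
theorem mulAut_mul_inv_mem_range_sqHom (φ : MulAut ZH) (t : ZH) : φ t * t⁻¹ ∈ sqHom.range := by
  rw [mem_range_sqHom_iff, modN_eq_level, map_mul, map_inv]
  have h : ZHatLevel.level 2 (φ t) = ZHatLevel.level 2 t := by
    apply Multiplicative.toAdd.injective
    rw [ZHatLevel.toAdd_level_aut, levelChar_two_eq_one, one_mul]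
  rw [h, mul_inv_cancel]

/-- Two ODD elements of `Ẑ` have quotient in `2Ẑ`. [cite: RibesZalesskii2010, Thm 2.7.1] -/
theorem mul_inv_mem_range_sqHom_of_odd {a b : ZH} (ha : ZHatLevel.level 2 a ≠ 1) (hb : ZHatLevel.level 2 b ≠ 1) :
    a * b⁻¹ ∈ sqHom.range := by
  rw [mem_range_sqHom_iff, modN_eq_level, map_mul, map_inv]
  have key : ∀ u v : Multiplicative (ZMod ((2 : ℕ+) : ℕ)), u ≠ 1 → v ≠ 1 → u * v⁻¹ = 1 := by decide
  exact key _ _ ha hb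

/-- **`2·κ_{−1}` is a `χ`-coboundary with ODD constant**: for the Kummer cocycle `κ_{−1}` of `−1 ∈ K̈^×` (root system
`r := ofRootableBy`), `κ_{−1}(σ)² = χ(σ)(c')/c'` with `level 2 c' ≠ 1` (the root system `r·r` of `1` has level-2 root
`(r.root 2)² = −1`). [cite: MochizukiEtTh2009, Def 1.9 p.29] -/
theorem exists_odd_coboundary_kappa_negOne_sq :
    ∃ c' : ZH, (∀ σ : GQp p,
      kappaUnitχ p (-1 : (↥(ThetaSetting.modelχ p).Kdd)ˣ) σ * kappaUnitχ p (-1) σ = chi p σ c' * c'⁻¹) ∧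
      ZHatLevel.level 2 c' ≠ 1 := by
  set r := RootSystem.ofRootableBy (unitχ p (-1 : (↥(ThetaSetting.modelχ p).Kdd)ˣ)) with hr
  have hf := unitχ_mem_fixedPoints p (-1 : (↥(ThetaSetting.modelχ p).Kdd)ˣ)
  have h1 : unitχ p (-1 : (↥(ThetaSetting.modelχ p).Kdd)ˣ) * unitχ p (-1) = 1 :=
    Units.ext (by rw [Units.val_mul, Units.val_one]; change (-1 : PadicAlgCl p) * -1 = 1; norm_num)
  have hroot : (r.mul r).root 2 ≠ 1 := by
    intro h
    have hsq : r.root 2 * r.root 2 = unitχ p (-1 : (↥(ThetaSetting.modelχ p).Kdd)ˣ) := by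
      rw [← pow_two]; exact r.pow_self 2
    rw [RootSystem.mul_root, hsq] at h
    have hval := congrArg (fun w : (PadicAlgCl p)ˣ => (w : PadicAlgCl p)) h
    change (-1 : PadicAlgCl p) = 1 at hval
    norm_num at hval
  obtain ⟨c', hc', hodd⟩ := exists_odd_coboundary_of_eq_one p (r.mul r) (mul_mem_fixedPoints_top' p hf hf) h1 hroot
  refine ⟨c', fun σ => ?_, hodd⟩
  rw [← hc' σ, kummerZH_mulRoots _ _ hf hf, kappaUnitχ_def]

/-- The `Ẑ`-algebra of §4: from `κ² = χ(c')/c'` and `m² = c'/t`, `(κ · (half(χ(t)/t))⁻¹)² = (χ(m)/m)²`. [folklore] -/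
private theorem negate_algebra {G : Type*} [CommGroup G] (χ : G →* G) {κ h m c' t : G}
    (hκ : κ * κ = χ c' * c'⁻¹) (hh : h * h = χ t * t⁻¹) (hm : m * m = c' * t⁻¹) :
    (κ * h⁻¹) * (κ * h⁻¹) = (χ m * m⁻¹) * (χ m * m⁻¹) := by
  have e1 : (κ * h⁻¹) * (κ * h⁻¹) = (κ * κ) * (h * h)⁻¹ := by
    apply Additive.ofMul.injective; simp only [ofMul_mul, ofMul_inv]; abel
  have e2 : (χ m * m⁻¹) * (χ m * m⁻¹) = χ (m * m) * (m * m)⁻¹ := by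
    rw [map_mul]; apply Additive.ofMul.injective; simp only [ofMul_mul, ofMul_inv]; abel
  rw [e1, e2, hκ, hh, hm, map_mul, map_inv]
  apply Additive.ofMul.injective; simp only [ofMul_mul, ofMul_inv]; abel

/-! ### §4. Conjugating `log(Ü)` by the deck element: `Ü ↦ −Ü` -/

/-- **THE DECK ELEMENT NEGATES THE COORDINATE.** For every ODD `t ∈ Ẑ`, conjugation by `ε := b^t ∈ Π^tp_X` on
`H¹(Π^tp_Ÿ, Δ_Θ)` sends the (inflated) coordinate class `log(Ü)` of the section datum to `log(Ü) + log(−1)`: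
`ε · infl log(Ü) = infl log(Ü) · infl κ̈(−1)`. Cocycle level: `(ε·f)(g) = f(ε⁻¹gε) = c^{(ŷ(g)·χ(σ)(t)·t⁻¹)/2}` (`σ = aug g`,
`Δ_Θ` central under `Δ^tp_X`), and `c^{(χ(σ)t/t)/2}` differs from `c^{κ_{−1}(σ)}` by the coboundary of `c^{m}`,
`m² = c'/t`. [cite: MochizukiEtTh2009, Def 1.9 p.29] -/
theorem conj_inl_bPowGfp_inflTheta_logUddχ_of_odd (hC : (ThetaSetting.modelχ p).Compat) {t : ZH}
    (ht : ZHatLevel.level 2 t ≠ 1) :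
    haveI := hC.GtpYdd_normal
    ContH1.conj (ThetaSetting.modelχ p).toTheta (ThetaSetting.modelχ p).DeltaTheta
        (SemidirectProduct.inl (bPowGfp t) : PiTpχ p)
        ((ThetaSetting.modelχ p).inflTheta (ThetaSetting.modelχ p).GtpYdd (kummerDataχSec p).logUdd) =
      (ThetaSetting.modelχ p).inflTheta (ThetaSetting.modelχ p).GtpYdd (kummerDataχSec p).logUdd *
        (ThetaSetting.modelχ p).inflTheta (ThetaSetting.modelχ p).GtpYdd
          ((kummerDataχSec p).kumYdd ((kummerDataχSec p).toKddHat (-1))) := by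
  haveI := hC.GtpYdd_normal
  letI : CommGroup ZH := { (inferInstance : Group ZH) with mul_comm := ZHatCompletion.mul_comm }
  obtain ⟨c', hc', hodd⟩ := exists_odd_coboundary_kappa_negOne_sq p
  -- the coboundary constant `m` with `m² = c'/t`
  set m : ZH := half ⟨c' * t⁻¹, mul_inv_mem_range_sqHom_of_odd hodd ht⟩ with hm_def
  have hm : m * m = c' * t⁻¹ := by rw [← pow_two, hm_def, half_sq]
  -- the inflated `log(Ü)` as the class of an explicit cocycle `F₀ g = c^{ŷ(g)/2}`
  obtain ⟨h₀, hL⟩ : ∃ h₀, (ThetaSetting.modelχ p).inflTheta (ThetaSetting.modelχ p).GtpYdd (kummerDataχSec p).logUdd =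
      ContH1.mk (fun g : ↥(ThetaSetting.modelχ p).GtpYdd =>
        (logUddFunχ p ⟨(ThetaSetting.modelχ p).toTheta (g : PiTpχ p), Subgroup.mem_map_of_mem (ThetaSetting.modelχ p).toTheta g.2⟩ : ↥(ThetaSetting.modelχ p).DeltaTheta))
        h₀ :=
    ⟨_, rfl⟩
  rw [hL, inflTheta_kumYdd_toKddHat_kummerDataχSec]
  -- conjugation acts on classes through `conjCocycle`, products through products of cocycles (both definitionally):
  -- compare the two cocycles modulo a coboundary
  refine (ContH1.mk_eq_mk_iff (ThetaSetting.modelχ p).GtpYdd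
      ((ContH1.conjCocycle (ThetaSetting.modelχ p).toTheta (ThetaSetting.modelχ p).DeltaTheta
        (SemidirectProduct.inl (bPowGfp t) : PiTpχ p) ⟨_, h₀⟩).1)
      ((fun g : ↥(ThetaSetting.modelχ p).GtpYdd =>
          (logUddFunχ p ⟨(ThetaSetting.modelχ p).toTheta (g : PiTpχ p), Subgroup.mem_map_of_mem (ThetaSetting.modelχ p).toTheta g.2⟩ : ↥(ThetaSetting.modelχ p).DeltaTheta)) *
        fun g : ↥(ThetaSetting.modelχ p).GtpYdd =>
          (deltaThetaCoordχ p (kappaUnitχ p (-1) (g : PiTpχ p).right) : ↥(ThetaSetting.modelχ p).DeltaTheta))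
      (ContH1.conjCocycle (ThetaSetting.modelχ p).toTheta (ThetaSetting.modelχ p).DeltaTheta
        (SemidirectProduct.inl (bPowGfp t) : PiTpχ p) ⟨_, h₀⟩).2
      (mul_mem h₀ (kappaUnitχ_aug_mem_contCocycles p (-1)))).mpr ⟨deltaThetaCoordχ p m, fun g => ?_⟩
  -- unfold the conjugate cocycle at `g`
  rw [Pi.mul_apply, ContH1.conjCocycle_apply]
  have hεr : (SemidirectProduct.inl (bPowGfp t) : PiTpχ p).right = 1 := SemidirectProduct.right_inl _
  rw [conjNormal_toTheta_eq_self p hεr]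
  -- the `y`-coordinate of `ε⁻¹ g ε`
  have hconj : ((MulAut.conjNormal ((SemidirectProduct.inl (bPowGfp t) : PiTpχ p)⁻¹) g :
      ↥(ThetaSetting.modelχ p).GtpYdd) : PiTpχ p) =
      (SemidirectProduct.inl (bPowGfp t) : PiTpχ p)⁻¹ * (g : PiTpχ p) * SemidirectProduct.inl (bPowGfp t) := by
    rw [MulAut.conjNormal_apply, inv_inv]
  have hy : yCoordχ p ((SemidirectProduct.inl (bPowGfp t) : PiTpχ p)⁻¹ * (g : PiTpχ p) *
        SemidirectProduct.inl (bPowGfp t)) =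
      yCoordχ p (g : PiTpχ p) * (chi p (g : PiTpχ p).right t * t⁻¹) := by
    rw [yCoordχ_mul, yCoordχ_mul, ← map_inv, ← map_inv, yCoordχ_inl_bPowGfp, yCoordχ_inl_bPowGfp,
      SemidirectProduct.mul_right, SemidirectProduct.right_inl, one_mul, map_one, MulAut.one_apply]
    apply Additive.ofMul.injective; simp only [ofMul_mul, ofMul_inv]; abel
  -- both `log(Ü)`-values are `c^{half(·)}` of elements of `2Ẑ`; compare after squaring
  have hyg : yCoordχ p (g : PiTpχ p) ∈ sqHom.range :=
    yThetaχ_mem_range_sqHom p (Subgroup.mem_map_of_mem (ThetaSetting.modelχ p).toTheta g.2)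
  have hq : chi p (g : PiTpχ p).right t * t⁻¹ ∈ sqHom.range := mulAut_mul_inv_mem_range_sqHom _ _
  -- rewrite the conjugated value as `log(Ü)(g) · c^{half(χt/t)}`
  have hval : logUddFunχ p ⟨(ThetaSetting.modelχ p).toTheta
        ((MulAut.conjNormal ((SemidirectProduct.inl (bPowGfp t) : PiTpχ p)⁻¹) g : ↥(ThetaSetting.modelχ p).GtpYdd) :
          PiTpχ p), Subgroup.mem_map_of_mem (ThetaSetting.modelχ p).toTheta (MulAut.conjNormal _ g).2⟩ =
      logUddFunχ p ⟨(ThetaSetting.modelχ p).toTheta (g : PiTpχ p), Subgroup.mem_map_of_mem (ThetaSetting.modelχ p).toTheta g.2⟩ *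
        deltaThetaCoordχ p (half ⟨chi p (g : PiTpχ p).right t * t⁻¹, hq⟩) := by
    unfold logUddFunχ
    rw [← map_mul, ← map_mul]
    congr 1
    congr 1
    apply Subtype.ext
    change yThetaχ p ((ThetaSetting.modelχ p).toTheta _) = yThetaχ p ((ThetaSetting.modelχ p).toTheta _) * _
    rw [yThetaχ_toTheta, yThetaχ_toTheta, hconj, hy]
  rw [show (⟨_, h₀⟩ : contCocycles (ThetaSetting.modelχ p).toTheta (ThetaSetting.modelχ p).DeltaTheta
      (ThetaSetting.modelχ p).GtpYdd).1 (MulAut.conjNormal (SemidirectProduct.inl (bPowGfp t) : PiTpχ p)⁻¹ g) = _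
    from hval]
  -- goal: (L · H)⁻¹ · (L · K) = conj_g (c^m) · (c^m)⁻¹, i.e. H⁻¹ · K = c^{χ(σ) m} · c^{-m}
  have step1 :
      (logUddFunχ p ⟨(ThetaSetting.modelχ p).toTheta (g : PiTpχ p),
          Subgroup.mem_map_of_mem (ThetaSetting.modelχ p).toTheta g.2⟩ *
          deltaThetaCoordχ p (half ⟨chi p (g : PiTpχ p).right t * t⁻¹, hq⟩))⁻¹ *
        (logUddFunχ p ⟨(ThetaSetting.modelχ p).toTheta (g : PiTpχ p),
          Subgroup.mem_map_of_mem (ThetaSetting.modelχ p).toTheta g.2⟩ *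
          deltaThetaCoordχ p (kappaUnitχ p (-1) (g : PiTpχ p).right)) =
      deltaThetaCoordχ p ((half ⟨chi p (g : PiTpχ p).right t * t⁻¹, hq⟩)⁻¹ * kappaUnitχ p (-1) (g : PiTpχ p).right) := by
    rw [map_mul, map_inv, mul_inv_rev, mul_assoc, inv_mul_cancel_left]
  -- in `Ẑ`: (half(χt/t))⁻¹ · κ_{−1}(σ) = χ(σ)(m) · m⁻¹ — checked after squaring (`Ẑ` is `2`-torsion-free)
  have step2 : (half ⟨chi p (g : PiTpχ p).right t * t⁻¹, hq⟩)⁻¹ * kappaUnitχ p (-1) (g : PiTpχ p).right =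
      chi p (g : PiTpχ p).right m * m⁻¹ := by
    apply sqHom_injective
    rw [sqHom_apply, sqHom_apply, pow_two, pow_two]
    have hh : half ⟨chi p (g : PiTpχ p).right t * t⁻¹, hq⟩ * half ⟨chi p (g : PiTpχ p).right t * t⁻¹, hq⟩ =
        chi p (g : PiTpχ p).right t * t⁻¹ := by rw [← pow_two, half_sq]
    rw [mul_comm ((half ⟨chi p (g : PiTpχ p).right t * t⁻¹, hq⟩)⁻¹)]
    exact negate_algebra (chi p (g : PiTpχ p).right).toMonoidHom (hc' _) hh hm
  have step3 : deltaThetaCoordχ p (chi p (g : PiTpχ p).right m * m⁻¹) =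
      MulAut.conjNormal ((ThetaSetting.modelχ p).toTheta (g : PiTpχ p)) (deltaThetaCoordχ p m) *
        (deltaThetaCoordχ p m)⁻¹ := by
    rw [map_mul, map_inv]
    congr 1
    exact deltaThetaCoordχ_chi p ((ThetaSetting.modelχ p).toTheta (g : PiTpχ p)) m
  exact step1.trans ((congrArg (deltaThetaCoordχ p) step2).trans step3)


/-! ### §5. One deck element with BOTH properties; p431196 fires at the model -/

/-- From the section identity to the decomposition groups (as in p442729). [folklore] -/
private theorem map_eq_comap_conj_of_conj_eq' {s s' : GQp p →* PiTpχ p} {ε : PiTpχ p}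
    (h : ∀ σ : GQp p, ε * s' σ * ε⁻¹ = s σ) (G : Subgroup (GQp p)) :
    G.map s' = (G.map s).comap (MulAut.conj ε).toMonoidHom := by
  ext x
  rw [Subgroup.mem_comap, MulEquiv.coe_toMonoidHom, MulAut.conj_apply]
  constructor
  · rintro ⟨σ, hσ, rfl⟩
    exact ⟨σ, hσ, (h σ).symm⟩
  · rintro ⟨σ, hσ, hx⟩
    refine ⟨σ, hσ, ?_⟩
    rw [← h σ] at hx
    exact mul_left_cancel (mul_right_cancel hx)

/-- **THE DECK ELEMENT OF `modelχ` IS THE `μ₂`-DECK TRANSFORMATION** (`p ≡ 1 (mod 4)`): there is `ε = b^t ∈ Π^tp_X` of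
`toZ`-degree `0` with `D_{τ⁻¹} = D_τ.comap (conj ε)` for the Def. 1.9 points `τ^{±1} = anchoredPointχ (√−1)^{±1}` AND
`ε · infl log(Ü) = infl log(Ü) · infl κ̈(−1)` — it relates the two 4-torsion sections and negates the coordinate
(«the 4-torsion point `τ⁻¹` determined by `−√−1`»). [cite: MochizukiEtTh2009, Def 1.9 p.29] -/
theorem exists_deck_negates_coord_modelχ (hp : p % 4 = 1) (hC : (ThetaSetting.modelχ p).Compat) :
    haveI := hC.GtpYdd_normal
    ∃ ε : PiTpχ p, (ThetaSetting.modelχ p).toZ ε = 1 ∧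
      (tauInvχ p hp).Dpt = (tauχ p hp).Dpt.comap (MulAut.conj ε).toMonoidHom ∧
      ContH1.conj (ThetaSetting.modelχ p).toTheta (ThetaSetting.modelχ p).DeltaTheta ε
          ((ThetaSetting.modelχ p).inflTheta (ThetaSetting.modelχ p).GtpYdd (kummerDataχSec p).logUdd) =
        (ThetaSetting.modelχ p).inflTheta (ThetaSetting.modelχ p).GtpYdd (kummerDataχSec p).logUdd *
          (ThetaSetting.modelχ p).inflTheta (ThetaSetting.modelχ p).GtpYdd
            ((kummerDataχSec p).kumYdd ((kummerDataχSec p).toKddHat (-1))) := by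
  haveI := hC.GtpYdd_normal
  obtain ⟨t, ht, hodd⟩ := exists_odd_deck_exponent p hp
  refine ⟨SemidirectProduct.inl (bPowGfp t), ?_, ?_, conj_inl_bPowGfp_inflTheta_logUddχ_of_odd p hC hodd⟩
  · rw [GfpTwistData.toZ_apply, SemidirectProduct.left_inl, gfpSnd_bPowGfp]
  · refine map_eq_comap_conj_of_conj_eq' p (fun σ => ?_) _
    rw [sectionOfUnitχ_def, sectionOfUnitχ_def]
    refine SemidirectProduct.ext ?_ ?_
    · rw [inl_bPowGfp_conj_sectionχ_left, sectionχ_left, Pi.mul_apply, Pi.mul_apply, ht σ]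
    · rw [inl_bPowGfp_conj_sectionχ_right, sectionχ_right]

/-- **This lineage's `exists_anchoredStandardData_of_deck` (p431196) FIRES at the model with every hypothesis
discharged**: from the ONE anchored point `τ = anchoredPointχ (√−1)`, the deck element `ε` above and Prop. 1.5 (ii)
(abc-iut-L6-d5), an `AnchoredStandardData` at `MuTwoSetting.modelχ` with `A.tau = τ`, `A.sqrtNegOne = √−1` and the deck
relation `D_{τ⁻¹} = D_τ.comap (conj ε)` — independently of the direct construction `anchoredStandardDataχSec` (p440892).
[cite: MochizukiEtTh2009, Def 1.9 p.29] -/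
theorem exists_anchoredStandardData_of_deck_modelχ (hp : p % 4 = 1) :
    ∃ (A : (MuTwoSetting.modelχ p).AnchoredStandardData (kummerDataχSec p)) (ε : PiTpχ p),
      A.tau = tauχ p hp ∧ A.sqrtNegOne = sqrtNegOneχ p hp ∧ (ThetaSetting.modelχ p).toZ ε = 1 ∧
        A.tauInv.Dpt = (tauχ p hp).Dpt.comap (MulAut.conj ε).toMonoidHom := by
  obtain ⟨ε, hε, -, hneg⟩ := exists_deck_negates_coord_modelχ p hp (MuTwoSetting.modelχ_compat p)
  obtain ⟨A, h1, h2, h3⟩ := MuTwoSetting.exists_anchoredStandardData_of_deck (M := MuTwoSetting.modelχ p)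
    (MuTwoSetting.modelχ_compat p) (prop15ii_kummerDataχSec p _) (sqrtNegOneχ p hp) (sqrtNegOneχ_mem_K p hp)
    (sqrtNegOneχ_sq p hp) (tauχ p hp) rfl ε hneg
  exact ⟨A, ε, h1, h2, hε, h3⟩

end Literature.AnabelianGeometry.EtaleTheta.SettingModel

end
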